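/- Free-seat work of EXTRA WIDTH SEAT `ym-line-cbag-p1-w5` (prover-ym-line-cbag-p1-w5-g3-0), route `EguchiKawaiDirectionLadder`
(ideator ym-idea-2, LINE 8), crux `TripleSmallBallMargin` (stmt-QuantumFields-27724), v7 S10-C glue: the OFF-BLOCK MASS bridge.
The off-block events `A₁, A₂` of the one-level decoupling are `{X : offDiagBlockSq ℓ X ≤ N s}` (width seat w3's `N`-uniform
small-ball bound `haar_offDiagBlockSq_smallBall`, `ℓ : Fin N → Option (Fin m)`), while the decoupling capstone speaks the
`toBlock` / `blockDiag` language of a `Fin (m+1)`-valued labelling (`ℓ' = finSuccEquivLast.symm ∘ ℓ`, collar = `Fin.last m`).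
This file writes `offDiagBlockSq` as a sum of block-pair Frobenius masses, proves its invariance under right multiplication by
block unitaries (the `h_off` verification) and the row/column block sub-sum bounds (the `h_far` inputs).  Pure bookkeeping,
ROUTE-INDEPENDENT.  Nothing here bears on the Yang–Mills mass gap. -/
import Summits.QuantumFields.YangMills.Theorems.EguchiKawaiDirectionLadderSingleLinkReductionCore
import Summits.QuantumFields.YangMills.Theorems.EguchiKawaiDirectionLadderBlockPairAlgebra
import Mathlib.Logic.Equiv.Fin.Basic
import HarnessLib

/-!
# Route `EguchiKawaiDirectionLadder`: off-block mass in block-pair form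

For `ℓ : Fin N → Option (Fin m)` let `ℓ' i := finSuccEquivLast.symm (ℓ i) : Fin (m+1)` (`some a ↦ castSucc a`, `none ↦ last`) and
`M_{ab}(X) := Σ_{i : ℓ' i = castSucc a} Σ_{j : ℓ' j = castSucc b} |X_{ij}|²` (the Frobenius mass of the block `X.toBlock (ℓ'=a) (ℓ'=b)`).

* `sum_sum_ite_cross_eq_blocks` — for any `L : Fin N → Fin (m+1)` and array `g`:
  `Σ_{j,k} [L j ≠ L k, L j ≠ last, L k ≠ last] g j k = Σ_{a : Fin m} Σ_{b ∈ univ.erase a} Σ_{i : {L = castSucc a}} Σ_{j : {L = castSucc b}} g i j`;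
* `offDiagBlockSq_eq_sum_blocks` (C1) — `offDiagBlockSq ℓ X = Σ_a Σ_{b ≠ a} M_{ab}(X)`;
* `offDiagBlockSq_mul_blockDiag` (C2, the `h_off` invariance) — `offDiagBlockSq ℓ (X · blockDiag ℓ' V) = offDiagBlockSq ℓ X` for every
  family of block unitaries `V` (width seat w4's `sum_norm_sq_toBlock_mul_blockDiag`);
* `rowBlocks_le_offDiagBlockSq`, `colBlocks_le_offDiagBlockSq` (+ `_filter` forms over `a ≠ last` in `Fin (m+1)`) (C3, the `h_far` inputs) —
  `Σ_{b ≠ c} M_{cb}(X) ≤ offDiagBlockSq ℓ X` and `Σ_{a ≠ c} M_{ac}(X) ≤ offDiagBlockSq ℓ X`;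
* `offDiagBlockSq_le_of_frobSq_comm_le` (C4, `E ⇒ A`) — with `γ`-separation across blocks,
  `‖diag(d)·X̃ − X̃·diag(d)‖_F² ≤ B` for `X̃ = X · blockDiag ℓ' V` gives `offDiagBlockSq ℓ X ≤ B/γ`.

HONEST FRAMING: bookkeeping only.  The route bears on the barrier-ledger fact `EguchiKawaiBreakdown`; the Yang–Mills mass gap is
NOT touched.
-/

set_option autoImplicit false

noncomputable section

open Finset
open scoped Matrix
open Literature.Barriers.QuantumFields

namespace Summit.QuantumFields.YangMills.Theorems.EguchiKawaiDirectionLadder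

namespace OffDiagBlocks

variable {N m : ℕ}

/-! ### §1 A general fibrewise identity for cross sums -/

/-- A filtered sum over a fibre of `L` as a sum over the fibre subtype. -/
theorem sum_filter_eq_sum_subtype (L : Fin N → Fin (m + 1)) (u : Fin (m + 1)) (h : Fin N → ℝ) :
    ∑ j ∈ univ.filter (fun j => L j = u), h j = ∑ j : {j // L j = u}, h j :=
  sum_subtype (univ.filter fun j => L j = u) (fun j => by simp) h

/-- Double fibrewise decomposition of a double sum along a labelling. -/
theorem sum_sum_eq_fiberwise (L : Fin N → Fin (m + 1)) (c : Fin N → Fin N → ℝ) :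
    ∑ j, ∑ k, c j k =
      ∑ u : Fin (m + 1), ∑ v : Fin (m + 1),
        ∑ j ∈ univ.filter (fun j => L j = u), ∑ k ∈ univ.filter (fun k => L k = v), c j k := by
  rw [← sum_fiberwise univ L (fun j => ∑ k, c j k)]
  refine sum_congr rfl fun u _ => ?_
  have hinner : ∀ j : Fin N, ∑ k, c j k = ∑ v : Fin (m + 1), ∑ k ∈ univ.filter (fun k => L k = v), c j k :=
    fun j => (sum_fiberwise univ L (fun k => c j k)).symm
  simp_rw [hinner]
  rw [sum_comm]

/-- **Cross sums in block-pair form**: for any labelling `L : Fin N → Fin (m+1)` (collar `last`) and any array `g`,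
`Σ_{j,k} [L j ≠ L k ∧ L j ≠ last ∧ L k ≠ last] g j k = Σ_{a : Fin m} Σ_{b ∈ univ.erase a} Σ_{i : {L = castSucc a}} Σ_{j : {L = castSucc b}} g i j`. -/
theorem sum_sum_ite_cross_eq_blocks (L : Fin N → Fin (m + 1)) (g : Fin N → Fin N → ℝ) :
    ∑ j, ∑ k, (if L j ≠ L k ∧ L j ≠ Fin.last m ∧ L k ≠ Fin.last m then g j k else 0) =
      ∑ a : Fin m, ∑ b ∈ univ.erase a,
        ∑ i : {i // L i = Fin.castSucc a}, ∑ j : {j // L j = Fin.castSucc b}, g i j := by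
  -- the condition is constant on fibres
  have hB : ∀ u v : Fin (m + 1),
      ∑ j ∈ univ.filter (fun j => L j = u), ∑ k ∈ univ.filter (fun k => L k = v),
          (if L j ≠ L k ∧ L j ≠ Fin.last m ∧ L k ≠ Fin.last m then g j k else 0) =
        if u ≠ v ∧ u ≠ Fin.last m ∧ v ≠ Fin.last m then
          ∑ j ∈ univ.filter (fun j => L j = u), ∑ k ∈ univ.filter (fun k => L k = v), g j k else 0 := by
    intro u v
    by_cases h : u ≠ v ∧ u ≠ Fin.last m ∧ v ≠ Fin.last m
    · rw [if_pos h]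
      refine sum_congr rfl fun j hj => sum_congr rfl fun k hk => ?_
      rw [mem_filter] at hj hk
      have hc : L j ≠ L k ∧ L j ≠ Fin.last m ∧ L k ≠ Fin.last m := by rw [hj.2, hk.2]; exact h
      rw [if_pos hc]
    · rw [if_neg h]
      refine sum_eq_zero fun j hj => sum_eq_zero fun k hk => ?_
      rw [mem_filter] at hj hk
      have hc : ¬ (L j ≠ L k ∧ L j ≠ Fin.last m ∧ L k ≠ Fin.last m) := by rw [hj.2, hk.2]; exact h
      rw [if_neg hc]
  rw [(sum_sum_eq_fiberwise L _).trans (sum_congr rfl fun u _ => sum_congr rfl fun v _ => hB u v)]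
  -- split off the collar label in `u` and in `v`
  rw [Fin.sum_univ_castSucc]
  have hlast : ∑ v : Fin (m + 1), (if Fin.last m ≠ v ∧ Fin.last m ≠ Fin.last m ∧ v ≠ Fin.last m then
      ∑ j ∈ univ.filter (fun j => L j = Fin.last m), ∑ k ∈ univ.filter (fun k => L k = v), g j k else 0) = 0 :=
    sum_eq_zero fun v _ => by rw [if_neg]; simp
  rw [hlast, add_zero]
  refine sum_congr rfl fun a _ => ?_
  rw [Fin.sum_univ_castSucc]
  have hlast' : (if Fin.castSucc a ≠ Fin.last m ∧ Fin.castSucc a ≠ Fin.last m ∧ Fin.last m ≠ Fin.last m then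
      ∑ j ∈ univ.filter (fun j => L j = Fin.castSucc a), ∑ k ∈ univ.filter (fun k => L k = Fin.last m), g j k
      else 0) = 0 := by
    rw [if_neg]; simp
  rw [hlast', add_zero]
  -- the remaining condition is `a ≠ b`
  have hcond : ∀ b : Fin m,
      (Fin.castSucc a ≠ Fin.castSucc b ∧ Fin.castSucc a ≠ Fin.last m ∧ Fin.castSucc b ≠ Fin.last m) ↔ a ≠ b := by
    intro b
    simp only [ne_eq, Fin.castSucc_inj, (Fin.castSucc_lt_last a).ne, (Fin.castSucc_lt_last b).ne,
      not_false_eq_true, and_true]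
  have hfilter : univ.erase a = univ.filter (fun b : Fin m => a ≠ b) := by
    ext b; simp [eq_comm]
  rw [hfilter, sum_filter]
  refine sum_congr rfl fun b _ => ?_
  by_cases hab : a ≠ b
  · rw [if_pos hab, if_pos ((hcond b).2 hab), sum_filter_eq_sum_subtype]
    exact Fintype.sum_congr _ _ fun i => sum_filter_eq_sum_subtype L _ _
  · rw [if_neg hab, if_neg (fun h => hab ((hcond b).1 h))]

/-! ### §2 `offDiagBlockSq` in block-pair form (C1) -/

/-- The `Option` condition is the `Fin (m+1)` condition after relabelling. -/
theorem cross_iff_relabel (o o' : Option (Fin m)) :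
    (o ≠ o' ∧ o ≠ none ∧ o' ≠ none) ↔
      (finSuccEquivLast.symm o ≠ finSuccEquivLast.symm o' ∧
        finSuccEquivLast.symm o ≠ Fin.last m ∧ finSuccEquivLast.symm o' ≠ Fin.last m) := by
  rw [ne_eq, ne_eq, ne_eq, ne_eq, ne_eq, ne_eq, finSuccEquivLast.symm.injective.eq_iff,
    ← finSuccEquivLast_symm_none, finSuccEquivLast.symm.injective.eq_iff, finSuccEquivLast.symm.injective.eq_iff]

/-- **(C1)** `offDiagBlockSq ℓ X = Σ_a Σ_{b ≠ a} Σ_{i : ℓ' = castSucc a} Σ_{j : ℓ' = castSucc b} |X_{ij}|²`, `ℓ' = finSuccEquivLast.symm ∘ ℓ`. -/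
theorem offDiagBlockSq_eq_sum_blocks (ℓ : Fin N → Option (Fin m)) (X : Matrix (Fin N) (Fin N) ℂ) :
    offDiagBlockSq ℓ X =
      ∑ a : Fin m, ∑ b ∈ univ.erase a,
        ∑ i : {i // finSuccEquivLast.symm (ℓ i) = Fin.castSucc a},
          ∑ j : {j // finSuccEquivLast.symm (ℓ j) = Fin.castSucc b},
            ‖X.toBlock (fun i => finSuccEquivLast.symm (ℓ i) = Fin.castSucc a)
              (fun j => finSuccEquivLast.symm (ℓ j) = Fin.castSucc b) i j‖ ^ 2 := by
  classical
  simp only [Matrix.toBlock_apply]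
  rw [← sum_sum_ite_cross_eq_blocks (fun i => finSuccEquivLast.symm (ℓ i)) (fun j k => ‖X j k‖ ^ 2)]
  unfold offDiagBlockSq
  refine sum_congr rfl fun j _ => sum_congr rfl fun k _ => ?_
  simp only [cross_iff_relabel]

/-! ### §3 Invariance under right multiplication by block unitaries (C2, the `h_off` verification) -/

/-- **(C2)** `offDiagBlockSq ℓ (X · blockDiag ℓ' V) = offDiagBlockSq ℓ X` for every family of block unitaries `V` of the
relabelling `ℓ'` (including a non-trivial collar block). -/
theorem offDiagBlockSq_mul_blockDiag (ℓ : Fin N → Option (Fin m)) (X : Matrix (Fin N) (Fin N) ℂ)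
    (V : BlockUnitaries (fun i => finSuccEquivLast.symm (ℓ i))) :
    offDiagBlockSq ℓ (X * blockDiag (fun i => finSuccEquivLast.symm (ℓ i))
        (fun b => (V b : Matrix {i : Fin N // finSuccEquivLast.symm (ℓ i) = b}
          {i : Fin N // finSuccEquivLast.symm (ℓ i) = b} ℂ))) =
      offDiagBlockSq ℓ X := by
  classical
  rw [offDiagBlockSq_eq_sum_blocks, offDiagBlockSq_eq_sum_blocks]
  refine sum_congr rfl fun a _ => sum_congr rfl fun b _ => ?_
  exact sum_norm_sq_toBlock_mul_blockDiag (fun i => finSuccEquivLast.symm (ℓ i)) X V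
    (fun i => finSuccEquivLast.symm (ℓ i) = Fin.castSucc a) (Fin.castSucc b)

/-- The same for a block-diagonal UNITARY factor `blockDiagUnitary ℓ' V`. -/
theorem offDiagBlockSq_mul_blockDiagUnitary (ℓ : Fin N → Option (Fin m)) (X : UN N)
    (V : BlockUnitaries (fun i => finSuccEquivLast.symm (ℓ i))) :
    offDiagBlockSq ℓ ((X * blockDiagUnitary (fun i => finSuccEquivLast.symm (ℓ i)) V : UN N) : Matrix (Fin N) (Fin N) ℂ) =
      offDiagBlockSq ℓ (X : Matrix (Fin N) (Fin N) ℂ) := by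
  rw [Matrix.UnitaryGroup.mul_val, coe_blockDiagUnitary]
  exact offDiagBlockSq_mul_blockDiag ℓ _ V

/-! ### §4 Row- and column-block sub-sums (C3, the `h_far` inputs) -/

/-- Block-pair masses are non-negative. -/
theorem blockMass_nonneg (ℓ : Fin N → Option (Fin m)) (X : Matrix (Fin N) (Fin N) ℂ) (a b : Fin m) :
    0 ≤ ∑ i : {i // finSuccEquivLast.symm (ℓ i) = Fin.castSucc a},
          ∑ j : {j // finSuccEquivLast.symm (ℓ j) = Fin.castSucc b},
            ‖X.toBlock (fun i => finSuccEquivLast.symm (ℓ i) = Fin.castSucc a)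
              (fun j => finSuccEquivLast.symm (ℓ j) = Fin.castSucc b) i j‖ ^ 2 :=
  sum_nonneg fun _ _ => sum_nonneg fun _ _ => by positivity

/-- **(C3, rows)** the far mass of block-row `c`: `Σ_{b ≠ c} M_{cb}(X) ≤ offDiagBlockSq ℓ X`. -/
theorem rowBlocks_le_offDiagBlockSq (ℓ : Fin N → Option (Fin m)) (X : Matrix (Fin N) (Fin N) ℂ) (c : Fin m) :
    ∑ b ∈ univ.erase c,
        ∑ i : {i // finSuccEquivLast.symm (ℓ i) = Fin.castSucc c},
          ∑ j : {j // finSuccEquivLast.symm (ℓ j) = Fin.castSucc b},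
            ‖X.toBlock (fun i => finSuccEquivLast.symm (ℓ i) = Fin.castSucc c)
              (fun j => finSuccEquivLast.symm (ℓ j) = Fin.castSucc b) i j‖ ^ 2 ≤
      offDiagBlockSq ℓ X := by
  rw [offDiagBlockSq_eq_sum_blocks]
  exact single_le_sum (f := fun a => ∑ b ∈ univ.erase a,
      ∑ i : {i // finSuccEquivLast.symm (ℓ i) = Fin.castSucc a},
        ∑ j : {j // finSuccEquivLast.symm (ℓ j) = Fin.castSucc b},
          ‖X.toBlock (fun i => finSuccEquivLast.symm (ℓ i) = Fin.castSucc a)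
            (fun j => finSuccEquivLast.symm (ℓ j) = Fin.castSucc b) i j‖ ^ 2)
    (fun a _ => sum_nonneg fun b _ => blockMass_nonneg ℓ X a b) (mem_univ c)

/-- **(C3, columns)** the far mass of block-column `c`: `Σ_{a ≠ c} M_{ac}(X) ≤ offDiagBlockSq ℓ X`. -/
theorem colBlocks_le_offDiagBlockSq (ℓ : Fin N → Option (Fin m)) (X : Matrix (Fin N) (Fin N) ℂ) (c : Fin m) :
    ∑ a ∈ univ.erase c,
        ∑ i : {i // finSuccEquivLast.symm (ℓ i) = Fin.castSucc a},
          ∑ j : {j // finSuccEquivLast.symm (ℓ j) = Fin.castSucc c},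
            ‖X.toBlock (fun i => finSuccEquivLast.symm (ℓ i) = Fin.castSucc a)
              (fun j => finSuccEquivLast.symm (ℓ j) = Fin.castSucc c) i j‖ ^ 2 ≤
      offDiagBlockSq ℓ X := by
  rw [offDiagBlockSq_eq_sum_blocks]
  calc ∑ a ∈ univ.erase c,
        ∑ i : {i // finSuccEquivLast.symm (ℓ i) = Fin.castSucc a},
          ∑ j : {j // finSuccEquivLast.symm (ℓ j) = Fin.castSucc c},
            ‖X.toBlock (fun i => finSuccEquivLast.symm (ℓ i) = Fin.castSucc a)
              (fun j => finSuccEquivLast.symm (ℓ j) = Fin.castSucc c) i j‖ ^ 2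
      ≤ ∑ a ∈ univ.erase c, ∑ b ∈ univ.erase a,
          ∑ i : {i // finSuccEquivLast.symm (ℓ i) = Fin.castSucc a},
            ∑ j : {j // finSuccEquivLast.symm (ℓ j) = Fin.castSucc b},
              ‖X.toBlock (fun i => finSuccEquivLast.symm (ℓ i) = Fin.castSucc a)
                (fun j => finSuccEquivLast.symm (ℓ j) = Fin.castSucc b) i j‖ ^ 2 := by
        refine sum_le_sum fun a ha => ?_
        have hc : c ∈ univ.erase a := by
          rw [mem_erase] at ha ⊢; exact ⟨fun h => ha.1 h.symm, mem_univ _⟩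
        exact single_le_sum (f := fun b => ∑ i : {i // finSuccEquivLast.symm (ℓ i) = Fin.castSucc a},
            ∑ j : {j // finSuccEquivLast.symm (ℓ j) = Fin.castSucc b},
              ‖X.toBlock (fun i => finSuccEquivLast.symm (ℓ i) = Fin.castSucc a)
                (fun j => finSuccEquivLast.symm (ℓ j) = Fin.castSucc b) i j‖ ^ 2)
          (fun b _ => blockMass_nonneg ℓ X a b) hc
    _ ≤ _ := sum_le_univ_sum_of_nonneg fun a => sum_nonneg fun b _ => blockMass_nonneg ℓ X a b

/-- The index set `{a : Fin (m+1) | a ≠ castSucc c, a ≠ last}` is the image of `univ.erase c` under `castSucc`. -/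
theorem filter_ne_last_erase_eq_map (c : Fin m) :
    (univ.erase (Fin.castSucc c)).filter (fun a : Fin (m + 1) => a ≠ Fin.last m) = (univ.erase c).map Fin.castSuccEmb := by
  ext a
  simp only [mem_filter, mem_erase, mem_univ, and_true, mem_map, Fin.coe_castSuccEmb]
  constructor
  · rintro ⟨hne, hlast⟩
    obtain ⟨b, rfl⟩ := Fin.exists_castSucc_eq.mpr hlast
    exact ⟨b, fun h => hne (by rw [h]), rfl⟩
  · rintro ⟨b, hb, rfl⟩
    exact ⟨fun h => hb (Fin.castSucc_injective _ h), (Fin.castSucc_lt_last b).ne⟩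

/-- **(C3, rows, `Fin (m+1)` index form)**: summing the block-row-`c` masses over all labels `a ≠ castSucc c`, `a ≠ last` of the
relabelling gives at most `offDiagBlockSq ℓ X`. -/
theorem rowBlocks_le_offDiagBlockSq_filter (ℓ : Fin N → Option (Fin m)) (X : Matrix (Fin N) (Fin N) ℂ) (c : Fin m) :
    ∑ a ∈ (univ.erase (Fin.castSucc c)).filter (fun a : Fin (m + 1) => a ≠ Fin.last m),
        ∑ i : {i // finSuccEquivLast.symm (ℓ i) = Fin.castSucc c},
          ∑ j : {j // finSuccEquivLast.symm (ℓ j) = a},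
            ‖X.toBlock (fun i => finSuccEquivLast.symm (ℓ i) = Fin.castSucc c)
              (fun j => finSuccEquivLast.symm (ℓ j) = a) i j‖ ^ 2 ≤
      offDiagBlockSq ℓ X := by
  rw [filter_ne_last_erase_eq_map, sum_map]
  exact rowBlocks_le_offDiagBlockSq ℓ X c

/-- **(C3, columns, `Fin (m+1)` index form)**. -/
theorem colBlocks_le_offDiagBlockSq_filter (ℓ : Fin N → Option (Fin m)) (X : Matrix (Fin N) (Fin N) ℂ) (c : Fin m) :
    ∑ a ∈ (univ.erase (Fin.castSucc c)).filter (fun a : Fin (m + 1) => a ≠ Fin.last m),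
        ∑ i : {i // finSuccEquivLast.symm (ℓ i) = a},
          ∑ j : {j // finSuccEquivLast.symm (ℓ j) = Fin.castSucc c},
            ‖X.toBlock (fun i => finSuccEquivLast.symm (ℓ i) = a)
              (fun j => finSuccEquivLast.symm (ℓ j) = Fin.castSucc c) i j‖ ^ 2 ≤
      offDiagBlockSq ℓ X := by
  rw [filter_ne_last_erase_eq_map, sum_map]
  exact colBlocks_le_offDiagBlockSq ℓ X c

/-! ### §5 `E ⇒ A` (C4) -/

/-- **(C4)** With `γ`-separation across blocks (`γ > 0`): if `‖diag(d)·X̃ − X̃·diag(d)‖_F² ≤ B` for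
`X̃ = X · blockDiag ℓ' V`, then `offDiagBlockSq ℓ X ≤ B / γ`. -/
theorem offDiagBlockSq_le_of_frobSq_comm_le (ℓ : Fin N → Option (Fin m)) {d : Fin N → ℂ} {γ B : ℝ} (hγ : 0 < γ)
    (hsep : ∀ j k, ℓ j ≠ ℓ k → ℓ j ≠ none → ℓ k ≠ none → γ ≤ ‖d j - d k‖ ^ 2)
    (X : Matrix (Fin N) (Fin N) ℂ) (V : BlockUnitaries (fun i => finSuccEquivLast.symm (ℓ i)))
    (hB : frobSq (Matrix.diagonal d *
        (X * blockDiag (fun i => finSuccEquivLast.symm (ℓ i))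
          (fun b => (V b : Matrix {i : Fin N // finSuccEquivLast.symm (ℓ i) = b}
            {i : Fin N // finSuccEquivLast.symm (ℓ i) = b} ℂ))) -
        (X * blockDiag (fun i => finSuccEquivLast.symm (ℓ i))
          (fun b => (V b : Matrix {i : Fin N // finSuccEquivLast.symm (ℓ i) = b}
            {i : Fin N // finSuccEquivLast.symm (ℓ i) = b} ℂ))) * Matrix.diagonal d) ≤ B) :
    offDiagBlockSq ℓ X ≤ B / γ := by
  have h := frobSq_diagonal_comm_ge_blocks ℓ hsep
    (X * blockDiag (fun i => finSuccEquivLast.symm (ℓ i))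
      (fun b => (V b : Matrix {i : Fin N // finSuccEquivLast.symm (ℓ i) = b}
        {i : Fin N // finSuccEquivLast.symm (ℓ i) = b} ℂ)))
  rw [offDiagBlockSq_mul_blockDiag] at h
  rw [le_div_iff₀ hγ, mul_comm]
  exact h.trans hB

/-- (C4) without the block factor: `‖diag(d)·X − X·diag(d)‖_F² ≤ B` gives `offDiagBlockSq ℓ X ≤ B / γ`. -/
theorem offDiagBlockSq_le_of_frobSq_comm_le' (ℓ : Fin N → Option (Fin m)) {d : Fin N → ℂ} {γ B : ℝ} (hγ : 0 < γ)
    (hsep : ∀ j k, ℓ j ≠ ℓ k → ℓ j ≠ none → ℓ k ≠ none → γ ≤ ‖d j - d k‖ ^ 2)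
    (X : Matrix (Fin N) (Fin N) ℂ) (hB : frobSq (Matrix.diagonal d * X - X * Matrix.diagonal d) ≤ B) :
    offDiagBlockSq ℓ X ≤ B / γ := by
  have h := frobSq_diagonal_comm_ge_blocks ℓ hsep X
  rw [le_div_iff₀ hγ, mul_comm]
  exact h.trans hB

end OffDiagBlocks

end Summit.QuantumFields.YangMills.Theorems.EguchiKawaiDirectionLadder

end
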